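import Summits.CriticalPhenomena.Ising3DConformalLimit.Theorems.ArmDressingArmDressingGlueDefs
import HarnessLib

/-!
# Route `ArmDressing`, crux `ArmDressingGlue` (stmt-CriticalPhenomena-15700): vocabulary, part 2 —
# named clauses of cruxes B and C

Second vocabulary file of the line `registered` (skeleton `Cruxes/ArmDressingGlue/Lines/birth.lean`), used by
the lead's stub `stub_dressedInversionCovarianceOfPos` (the Camia–Feng §3.2.3 bookkeeping).  The cruxes
B = `EvenPatternDecoupling` and C = `ArmExtensionFactorisation` quantify, for a system of `n` disjoint closed
balls `B̄(c_j, r_j)`, over witnesses `q, v` (clause (i)) and `Λ, W, w` (clause (ii)); the bookkeeping has to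
talk about these witnesses for SEVERAL systems at once (a system at `z`, its image under the unit
inversion, their dilates), so the four clause shapes are named here as predicates of the witnesses:

* `CArm n c r v`   — clause (i) of C for the system `(c, r)`: `v` continuous and positive on the product of
  the open balls, and `P[CROSS(pts, Dᶜ)]/arm1ⁿ → v` locally uniformly there;
* `CFam n c r z a W` — the inner-family half of clause (ii) of C at the point `z` with multipliers `a`;
* `COne w`          — the one-point half of clause (ii) of C (at the origin, outer ball `B(0,1)`);
* `BPat n c r q`    — clause (i) of B; `BFam n c r z t` — clause (ii) of B at `z` with target value `t`.

`cArm_extract` / `bPat_extract` read cruxes C and B (through the `Iff.rfl` lemmas of part 1) as existence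
statements for these predicates — one `obtain` each; `stub_invVocabulary` is the registered bookkeeping stub
through which this file lands.  Nothing is asserted.

Reference: F. Camia, Y. Feng, arXiv:2411.01467 (SPA 2025), Lemmas 12, 14, 15–17 and §3.2.3.
-/

noncomputable section

namespace Summit.CriticalPhenomena.Ising3DConformalLimit.Cruxes.ArmDressingGlue.Vocab

open scoped BigOperators Topology Classical
open Filter Set
open Literature.Probability.LatticeModels Literature.Probability.Percolation
open Summit.CriticalPhenomena.Ising3DConformalLimit.Theses

/-! ### Clause shapes of crux C = `ArmExtensionFactorisation` -/

/-- Clause (i) of crux C for the ball system `(c, r)`: the joint-arm ratio `P[CROSS(pts, Dᶜ)]/arm1(δ,1)ⁿ`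
converges locally uniformly on `∏ B(c_j, r_j)` to `v`, continuous and positive there.
A predicate on the witness `v`; nothing asserted. -/
def CArm (n : ℕ) (c : Fin n → EuclideanSpace ℝ (Fin 3)) (r : Fin n → ℝ)
    (v : (Fin n → EuclideanSpace ℝ (Fin 3)) → ℝ) : Prop :=
  ContinuousOn v {z | ∀ j, z j ∈ Metric.ball (c j) (r j)} ∧
  (∀ z : Fin n → EuclideanSpace ℝ (Fin 3), (∀ j, z j ∈ Metric.ball (c j) (r j)) → 0 < v z) ∧
  TendstoLocallyUniformlyOn
    (fun δ z => Pr (n + n) (Fin.append (pts n δ z)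
      (fun j => disc δ (Metric.ball (c j) (r j))ᶜ)) (CROSS n) / (arm1 δ 1) ^ n)
    v (𝓝[>] 0) {z | ∀ j, z j ∈ Metric.ball (c j) (r j)}

/-- The inner-family half of clause (ii) of crux C at the point `z` with multipliers `a` and witness `W`:
for every family of inner closed balls shrinking to the points, eventually in the middle radius `η`, the
`δ → 0⁺` limit of `P[inner ↔ Dᶜ]/P[inner ↔ B(z_j, η a_j)ᶜ]` exists for small inner radii and tends to `W η`
as the inner radius parameter `η' → 0⁺`.  A predicate; nothing asserted. -/
def CFam (n : ℕ) (c : Fin n → EuclideanSpace ℝ (Fin 3)) (r : Fin n → ℝ)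
    (z : Fin n → EuclideanSpace ℝ (Fin 3)) (a : Fin n → ℝ) (W : ℝ → ℝ) : Prop :=
  ∀ (ci : ℝ → Fin n → EuclideanSpace ℝ (Fin 3)) (ri : ℝ → Fin n → ℝ),
    (∀ j, Tendsto (fun η' => ri η' j) (𝓝[>] 0) (𝓝 0)) →
    (∀ᶠ η' in 𝓝[>] 0, ∀ j, 0 < ri η' j ∧ z j ∈ Metric.ball (ci η' j) (ri η' j / 2)) →
    ∀ᶠ η in 𝓝[>] 0, ∃ Λ : ℝ → ℝ,
      (∀ᶠ η' in 𝓝[>] 0, Tendsto (fun δ =>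
        Pr (n + n) (fam n δ (fun j => Metric.closedBall (ci η' j) (ri η' j))
          (fun j => (Metric.ball (c j) (r j))ᶜ)) (CROSS n) /
        Pr (n + n) (fam n δ (fun j => Metric.closedBall (ci η' j) (ri η' j))
          (fun j => (Metric.ball (z j) (η * a j))ᶜ)) (CROSS n)) (𝓝[>] 0) (𝓝 (Λ η'))) ∧
      Tendsto Λ (𝓝[>] 0) (𝓝 (W η))

/-- The one-point half of clause (ii) of crux C with witness `w`: the same as `CFam` for one inner ball
around the origin, outer ball `B(0,1)` and middle ball `B(0,η)`.  A predicate; nothing asserted. -/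
def COne (w : ℝ → ℝ) : Prop :=
  ∀ (ci : ℝ → EuclideanSpace ℝ (Fin 3)) (ri : ℝ → ℝ), Tendsto ri (𝓝[>] 0) (𝓝 0) →
    (∀ᶠ η' in 𝓝[>] 0, 0 < ri η' ∧ (0 : EuclideanSpace ℝ (Fin 3)) ∈ Metric.ball (ci η') (ri η' / 2)) →
    ∀ᶠ η in 𝓝[>] 0, ∃ Λ : ℝ → ℝ,
      (∀ᶠ η' in 𝓝[>] 0, Tendsto (fun δ =>
        Pr 2 ![disc δ (Metric.closedBall (ci η') (ri η')),
          disc δ (Metric.ball (0 : EuclideanSpace ℝ (Fin 3)) 1)ᶜ] {R | R 0 1} /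
        Pr 2 ![disc δ (Metric.closedBall (ci η') (ri η')),
          disc δ (Metric.ball (0 : EuclideanSpace ℝ (Fin 3)) η)ᶜ] {R | R 0 1}) (𝓝[>] 0) (𝓝 (Λ η'))) ∧
      Tendsto Λ (𝓝[>] 0) (𝓝 (w η))

/-- Crux C read as: every system of `n ≥ 1` disjoint closed balls has a witness `v` of `CArm`, and at every
point of the open balls and every positive multipliers, witnesses `W, w` of `CFam`, `COne` with
`W(η)/∏ⱼ w(η aⱼ) → v z`.  Immediate from `armExtensionFactorisation_iff`. [cite: CamiaFeng2025, Lemmas 15–17] -/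
theorem cArm_extract (hC : ArmDressing.ArmExtensionFactorisation) {n : ℕ} (hn : 1 ≤ n)
    (c : Fin n → EuclideanSpace ℝ (Fin 3)) (r : Fin n → ℝ) (hr : ∀ j, 0 < r j)
    (hd : ∀ j k, j ≠ k → Disjoint (Metric.closedBall (c j) (r j)) (Metric.closedBall (c k) (r k))) :
    ∃ v : (Fin n → EuclideanSpace ℝ (Fin 3)) → ℝ, CArm n c r v ∧
      ∀ z : Fin n → EuclideanSpace ℝ (Fin 3), (∀ j, z j ∈ Metric.ball (c j) (r j)) →
        ∀ a : Fin n → ℝ, (∀ j, 0 < a j) → ∃ (W : ℝ → ℝ) (w : ℝ → ℝ),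
          CFam n c r z a W ∧ COne w ∧ Tendsto (fun η => W η / ∏ j, w (η * a j)) (𝓝[>] 0) (𝓝 (v z)) := by
  obtain ⟨v, h1, h2, h3, h4⟩ := armExtensionFactorisation_iff.1 hC n hn c r hr hd
  exact ⟨v, ⟨h1, h2, h3⟩, h4⟩

/-! ### Clause shapes of crux B = `EvenPatternDecoupling` -/

/-- Clause (i) of crux B for the ball system `(c, r)`: `P[EVEN(pts)]/P[CROSS(pts, Dᶜ)] → q` locally
uniformly on `∏ B(c_j, r_j)`, `q` continuous and positive there.  A predicate; nothing asserted. -/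
def BPat (n : ℕ) (c : Fin n → EuclideanSpace ℝ (Fin 3)) (r : Fin n → ℝ)
    (q : (Fin n → EuclideanSpace ℝ (Fin 3)) → ℝ) : Prop :=
  ContinuousOn q {z | ∀ j, z j ∈ Metric.ball (c j) (r j)} ∧
  (∀ z : Fin n → EuclideanSpace ℝ (Fin 3), (∀ j, z j ∈ Metric.ball (c j) (r j)) → 0 < q z) ∧
  TendstoLocallyUniformlyOn
    (fun δ z => Pr n (pts n δ z) (EVEN n) /
      Pr (n + n) (Fin.append (pts n δ z) (fun j => disc δ (Metric.ball (c j) (r j))ᶜ)) (CROSS n))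
    q (𝓝[>] 0) {z | ∀ j, z j ∈ Metric.ball (c j) (r j)}

/-- Clause (ii) of crux B at the point `z` with target value `t`: for every family of inner closed balls
shrinking to the points, the `δ → 0⁺` limit of `P[EVEN2 ∩ CROSS]/P[CROSS]` (inner balls, exteriors of the
`D_j`) exists eventually in the inner radius parameter and tends to `t`.  A predicate; nothing asserted. -/
def BFam (n : ℕ) (c : Fin n → EuclideanSpace ℝ (Fin 3)) (r : Fin n → ℝ)
    (z : Fin n → EuclideanSpace ℝ (Fin 3)) (t : ℝ) : Prop :=
  ∀ (ci : ℝ → Fin n → EuclideanSpace ℝ (Fin 3)) (ri : ℝ → Fin n → ℝ),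
    (∀ j, Tendsto (fun η => ri η j) (𝓝[>] 0) (𝓝 0)) →
    (∀ᶠ η in 𝓝[>] 0, ∀ j, 0 < ri η j ∧ z j ∈ Metric.ball (ci η j) (ri η j / 2)) →
    ∃ Λ : ℝ → ℝ,
      (∀ᶠ η in 𝓝[>] 0, Tendsto (fun δ =>
        Pr (n + n) (fam n δ (fun j => Metric.closedBall (ci η j) (ri η j))
          (fun j => (Metric.ball (c j) (r j))ᶜ)) (EVEN2 n ∩ CROSS n) /
        Pr (n + n) (fam n δ (fun j => Metric.closedBall (ci η j) (ri η j))
          (fun j => (Metric.ball (c j) (r j))ᶜ)) (CROSS n)) (𝓝[>] 0) (𝓝 (Λ η))) ∧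
      Tendsto Λ (𝓝[>] 0) (𝓝 t)

/-- Crux B read as: every system of `n ≥ 2` (`n` even) disjoint closed balls has a witness `q` of `BPat`,
and `BFam` holds at every point of the open balls with target `q z`.  Immediate from
`evenPatternDecoupling_iff`. [cite: CamiaFeng2025, Lemmas 12 and 14] -/
theorem bPat_extract (hB : ArmDressing.EvenPatternDecoupling) {n : ℕ} (hn : 2 ≤ n) (he : Even n)
    (c : Fin n → EuclideanSpace ℝ (Fin 3)) (r : Fin n → ℝ) (hr : ∀ j, 0 < r j)
    (hd : ∀ j k, j ≠ k → Disjoint (Metric.closedBall (c j) (r j)) (Metric.closedBall (c k) (r k))) :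
    ∃ q : (Fin n → EuclideanSpace ℝ (Fin 3)) → ℝ, BPat n c r q ∧
      ∀ z : Fin n → EuclideanSpace ℝ (Fin 3), (∀ j, z j ∈ Metric.ball (c j) (r j)) → BFam n c r z (q z) := by
  obtain ⟨q, h1, h2, h3, h4⟩ := evenPatternDecoupling_iff.1 hB n hn he c r hr hd
  exact ⟨q, ⟨h1, h2, h3⟩, h4⟩

/-- Registered bookkeeping stub `stub_invVocabulary` of the skeleton (existence of the `CArm` witness from
crux C), through which this vocabulary file lands. [folklore] -/
theorem stub_invVocabulary : ArmDressing.ArmExtensionFactorisation → ∀ (n : ℕ), 1 ≤ n → ∀ (c : Fin n → EuclideanSpace ℝ (Fin 3)) (r : Fin n → ℝ), (∀ j, 0 < r j) → (∀ j k, j ≠ k → Disjoint (Metric.closedBall (c j) (r j)) (Metric.closedBall (c k) (r k))) → ∃ v, CArm n c r v :=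
  fun hC _ hn c r hr hd => (cArm_extract hC hn c r hr hd).imp fun _ h => h.1

end Summit.CriticalPhenomena.Ising3DConformalLimit.Cruxes.ArmDressingGlue.Vocab

end
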